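import Literature.IUT.LogVolume.Corollary22ThetaClosureGalois
import Literature.IUT.LogVolume.Corollary22ThetaClosureFieldReading
import Literature.IUT.LogVolume.Corollary22CondP6Transport
import Literature.IUT.LogVolume.Corollary22FullGaloisImage
import Literature.IUT.LogVolume.Corollary22CondP6Five
import Literature.IUT.LogVolume.Corollary22ThetaFieldExists
import Literature.IUT.LogVolume.InitialThetaDataVolumeInhabited
import Literature.IUT.LogVolume.GenuineLogThetaPoint
import Literature.IUT.HodgeTheaters.InitialThetaDataSemistable
import Literature.IUT.HodgeTheaters.InitialThetaDataConditions
import Literature.IUT.HodgeTheaters.ImageContainsSL2Bridge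
import Literature.IUT.HodgeTheaters.InitialThetaDataTripodGaloisImage
import Literature.NumberTheory.EllipticCurves.TorsionRationalCoprimeProofs
import HarnessLib

/-!
# Initial Θ-data on the THETA CLOSURE FIELD `F‡` at a point of the `λ`-line, and `ThetaDataExistsAt`

Mochizuki, *Inter-universal Teichmüller theory IV*, RIMS manuscript (Apr. 2020; = PRIMS **57** (2021)),
proof of Cor. 2.2 (ii), p. 46: "it follows formally from (P1), (P2), (P5), and (P6) that, if one takes … the
“`F`” of [IUTchI], Definition 3.1, to be the number field `F` … “`X_F`” … the once-punctured elliptic curve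
associated to `E_F`, … “`𝕍^bad_mod`” … the set `𝕍^bad_mod` of (P5), then there exist data … such that all of the
conditions of [IUTchI], Definition 3.1, (a)–(f), are satisfied … (P7)".

THIS FILE is the route's layer-2 child (i) «ThetaDataExists(P, l)» in the cell's READING OF RECORD (abc-iut-plan
2026-08-26T02:59:03Z; findings F-L5t7-1 and F-L5t7-2): `F := F‡(P) = F_tpd(√−1, √λ, √(λ−1), E_λ[15])`
(`thetaClosureField`, Galois over `F_mod`: `Corollary22ThetaClosureGalois.lean`), `E_F := E_λ ⊗ F‡` the LEGENDRE
curve (`thetaCurve`). From EXACTLY the binders of `Cor22.Thm110Legendre` / the registered `stub_thetaData`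
(`P ∈ U_P`, `l` prime, `5 ≤ l`, `AdmitsCore P`, `CondP2`, `CondP5`, `CondP6`) it proves:

* `torsion_thirty_rational_thetaClosure` — `E_λ[30] ⊆ E_λ(F‡)` (2-torsion: `y = 0`, `x ∈ {0, 1, λ}`; 15-torsion:
  `Gal(F̄‡/F‡)`-fixed (`torsion_fifteen_fixed`) ⟹ rational (the tree's `fixedPoints_eq_range_map_holds`); `30 = 2·15`
  by abc-iut-L5-t12's `torsion_mem_range_baseChange_of_coprime`);
* `isGalois_fieldOfModuli_thetaClosure`, `finrank_fieldOfModuli_thetaClosure_coprime` — Def. 3.1 (b) in the exact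
  shape of `ArithInput` (`F_mod` = `ℚ(j(E_F)) ⊆ F‡` receives `FMod P` by `jInv ↦ j`);
* `placeInput_thetaClosure` — the `F‡`-level (P5) place, (P2) at the (P5) places, (P6) over `F‡`
  (campaign-S dictionary: `ord` scales by `e(w|v) > 0`; `l ∤ e ∣ [F‡:F_tpd]`; abc-iut-S5's
  `imageModLContainsSL2_of_condP6` + abc-iut-L5-t12's bridge);
* **`exists_initialThetaData_thetaClosure`** — initial Θ-data `D` on `(F‡, E_λ ⊗ F‡, l)` EXIST with `𝕍^bad_mod` the
  (P5) choice, GIVEN the `π₁`-geometric interface of [IUTchI] Def. 3.1 (d)(e)(f) (`BadPlacePredicates`,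
  `ThetaGeometry`: campaign-L objects, explicit binders);
* **`thetaDataExistsAt_of_condP6_thetaClosure`** — hence `Cor22.ThetaDataExistsAt P l` (the v3 datum of
  `GenuineLogThetaPoint.lean` is inhabited: `isSubThetaField_thetaClosureField` (abc-iut-w4-d037), ideles by
  `ThetaData.exists_isVolumeInputOf` (abc-iut-w5-d209)).

Classical; TAKES NO SIDE on [IUTchIII] Cor. 3.12 (initial Θ-data EXIST; what Thm. 1.10 / Cor. 3.12 assert about
them is not touched). IUT quotations carry [claim: Mochizuki2012, status: disputed].
-/

noncomputable section

open scoped Classical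

namespace Literature.IUT.LogVolume

namespace Cor22

open NumberField IsDedekindDomain Literature.NumberTheory.DiophantineGeometry.GenEll
open Literature.NumberTheory.EllipticCurves WeierstrassCurve IntermediateField Field
open Literature.IUT.HodgeTheaters

variable (P : NFPoint)

/-! ## Rational points from coordinates -/

section Rational

variable {k : Type} {L : Type} [Field k] [Field L] [Algebra k L] (W : WeierstrassCurve k)

/-- An affine point of `W(L)` whose coordinates come from `k` is the image of a point of `W(k)`
(nonsingularity descends along the injective `k → L`). [cite: SilvermanAEC2009, VIII.§1] -/
theorem some_mem_range_baseChange_of_mem {x y : L} (h : (W.baseChange L).toAffine.Nonsingular x y)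
    (hx : x ∈ Set.range (algebraMap k L)) (hy : y ∈ Set.range (algebraMap k L)) :
    (Affine.Point.some x y h : (W.baseChange L).toAffine.Point) ∈
      Set.range (Affine.Point.baseChange (W' := W.toAffine) k L) := by
  obtain ⟨x₀, rfl⟩ := hx
  obtain ⟨y₀, rfl⟩ := hy
  have h₀ : (W.baseChange k).toAffine.Nonsingular x₀ y₀ :=
    (Affine.baseChange_nonsingular W (Algebra.ofId k L).injective x₀ y₀).mp h
  exact ⟨Affine.Point.some x₀ y₀ h₀, rfl⟩

end Rational

/-! ## `E_λ[30] ⊆ E_λ(F‡)` -/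

section Torsion

variable [Fact P.InU]

/-- **The `2`-torsion of `E_λ ⊗ F‡` is rational**: a point `(x, y)` of order `2` of `y² = x(x−1)(x−λ)` has `y = 0` and
`x ∈ {0, 1, λ}`. [cite: SilvermanAEC2009, III.§2 (group law: points of order 2)] -/
theorem two_torsion_mem_range_thetaClosure
    (T : ((thetaCurve P (thetaClosureField P)).baseChange (AlgebraicClosure (thetaClosureField P))).toAffine.Point)
    (hT : (2 : ℤ) • T = 0) :
    T ∈ Set.range (Affine.Point.baseChange (W' := (thetaCurve P (thetaClosureField P)).toAffine)
      (thetaClosureField P) (AlgebraicClosure (thetaClosureField P))) := by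
  rcases T with _ | ⟨x, y, h⟩
  · exact ⟨0, rfl⟩
  · -- `T = −T`, so `y = −y`, so `y = 0`
    have hneg : Affine.Point.some x y h = -Affine.Point.some x y h := by
      rw [← add_eq_zero_iff_eq_neg, ← two_zsmul]; exact hT
    rw [Affine.Point.neg_some] at hneg
    have hy' := (Affine.Point.some.inj hneg).2
    simp only [Affine.negY, WeierstrassCurve.baseChange, WeierstrassCurve.map, map_zero,
      zero_mul, sub_zero] at hy'
    have hy : y = 0 := by
      have : (2 : AlgebraicClosure (thetaClosureField P)) * y = 0 := by rw [two_mul]; nth_rw 1 [hy']; ring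
      rcases mul_eq_zero.1 this with h2 | h2
      · norm_num at h2
      · exact h2
    subst hy
    -- the equation: `0 = x(x−1)(x−λ)`
    have heq := (Affine.equation_iff x (0 : AlgebraicClosure (thetaClosureField P))).1 h.1
    simp only [WeierstrassCurve.baseChange, WeierstrassCurve.map, map_zero, map_neg, map_add,
      map_one] at heq
    set la := algebraMap (thetaClosureField P) (AlgebraicClosure (thetaClosureField P))
      (algebraMap P.F (thetaClosureField P) P.x) with hla
    have hprod : x * (x - 1) * (x - la) = 0 := by
      have : x ^ 3 + -(1 + la) * x ^ 2 + la * x + 0 = 0 := by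
        rw [← heq]; ring
      rw [← this]; ring
    have hx : x ∈ Set.range (algebraMap (thetaClosureField P) (AlgebraicClosure (thetaClosureField P))) := by
      rcases mul_eq_zero.1 hprod with h12 | h3
      · rcases mul_eq_zero.1 h12 with h1 | h2
        · exact ⟨0, by rw [map_zero, h1]⟩
        · exact ⟨1, by rw [map_one]; exact (sub_eq_zero.1 h2).symm⟩
      · exact ⟨algebraMap P.F (thetaClosureField P) P.x, by rw [← hla]; exact (sub_eq_zero.1 h3).symm⟩
    exact some_mem_range_baseChange_of_mem _ h hx ⟨0, map_zero _⟩

/-- **The `15`-torsion of `E_λ ⊗ F‡` is rational**: it is fixed by `Gal(F̄‡/F‡)` (`torsion_fifteen_fixed`), hence in the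
image of `E(F‡)` (Galois descent for points, the tree's `fixedPoints_eq_range_map_holds`).
[cite: SilvermanAEC2009, VIII.§1 (proof of Prop. 1.2)] -/
theorem fifteen_torsion_mem_range_thetaClosure (hU : P.InU)
    (T : ((thetaCurve P (thetaClosureField P)).baseChange (AlgebraicClosure (thetaClosureField P))).toAffine.Point)
    (hT : (15 : ℤ) • T = 0) :
    T ∈ Set.range (Affine.Point.baseChange (W' := (thetaCurve P (thetaClosureField P)).toAffine)
      (thetaClosureField P) (AlgebraicClosure (thetaClosureField P))) := by
  set T' : geomPoints (thetaCurve P (thetaClosureField P)) := T with hT'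
  have hfix : T' ∈ MulAction.fixedPoints (absoluteGaloisGroup (thetaClosureField P))
      (geomPoints (thetaCurve P (thetaClosureField P))) :=
    (MulAction.mem_fixedPoints).2 fun σ => torsion_fifteen_fixed P hU σ T hT
  rw [fixedPoints_eq_range_map_holds (thetaCurve P (thetaClosureField P))] at hfix
  obtain ⟨Q, hQ⟩ := hfix
  exact ⟨Q, hQ⟩

/-- **`E_λ[30] ⊆ E_λ(F‡)`** ("the `(3·5)`-torsion points of `E_F` are defined over `F`", [IUTchIV] Thm. 1.10 p. 22, with
the `2`-torsion of Def. 3.1 (b); `30 = 2·15`). [claim: Mochizuki2012, status: disputed] -/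
theorem torsion_thirty_rational_thetaClosure (hU : P.InU)
    [(thetaCurve P (thetaClosureField P)).IsElliptic] :
    ∀ T : GeomPoints (AlgebraicClosure (thetaClosureField P)) (thetaCurve P (thetaClosureField P)),
      (30 : ℤ) • T = 0 →
        T ∈ Set.range (Affine.Point.baseChange (W' := (thetaCurve P (thetaClosureField P)).toAffine)
          (thetaClosureField P) (AlgebraicClosure (thetaClosureField P))) := by
  intro T hT
  exact torsion_mem_range_baseChange_of_coprime (thetaCurve P (thetaClosureField P)) (m := 2) (n := 15)
    (by norm_num) (fun T hT => two_torsion_mem_range_thetaClosure P T hT)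
    (fun T hT => fifteen_torsion_mem_range_thetaClosure P hU T hT) T (by exact_mod_cast hT)

end Torsion

/-! ## `F_mod = ℚ(j(E_F)) ⊆ F‡`: Def. 3.1 (b) in the shape of `ArithInput` -/

section Moduli

variable [Fact P.InU]

/-- `FMod P → ℚ(j(E_F)) ⊆ F‡`: the image of `F_mod = ℚ(j(λ))` in `F‡` is the field of moduli of `E_λ ⊗ F‡`
(`j(E_λ ⊗ F‡) = j(λ)`). [cite: Mochizuki2012, IUTchIV Prop. 1.8 (ii) p. 18] -/
theorem algebraMap_fMod_mem_fieldOfModuli (hU : P.InU) [hE : (thetaCurve P (thetaClosureField P)).IsElliptic]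
    (c : FMod P) :
    algebraMap (FMod P) (thetaClosureField P) c ∈ fieldOfModuli (thetaCurve P (thetaClosureField P)) := by
  haveI : IsScalarTower ℚ P.F (thetaClosureField P) := IsScalarTower.of_algebraMap_eq fun q => by simp [map_ratCast]
  let ψ : P.F →ₐ[ℚ] thetaClosureField P := (Algebra.ofId P.F (thetaClosureField P)).restrictScalars ℚ
  have hj : (thetaCurve P (thetaClosureField P)).j = algebraMap P.F (thetaClosureField P) (jInv P.x) := by
    have := thetaCurve_j (F := thetaClosureField P) hU
    convert this using 2
  have hmap : (IntermediateField.adjoin ℚ ({jInv P.x} : Set P.F)).map ψ =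
      fieldOfModuli (thetaCurve P (thetaClosureField P)) := by
    unfold fieldOfModuli
    rw [IntermediateField.adjoin_map, Set.image_singleton, hj]
    rfl
  have hc : (c : P.F) ∈ IntermediateField.adjoin ℚ ({jInv P.x} : Set P.F) := c.2
  have : ψ c ∈ (IntermediateField.adjoin ℚ ({jInv P.x} : Set P.F)).map ψ := ⟨c, hc, rfl⟩
  rw [hmap] at this
  rw [IsScalarTower.algebraMap_apply (FMod P) P.F (thetaClosureField P)]
  exact this

/-- **`F‡` is Galois over the field of moduli `ℚ(j(E_F)) ⊆ F‡`** — [IUTchI] Def. 3.1 (b) in the exact shape of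
`InitialThetaData.isGalois_fieldOfModuli` (from `isGalois_fMod_thetaClosureField` along `F_mod → ℚ(j(E_F)) ⊆ F‡`).
[claim: Mochizuki2012, status: disputed] -/
theorem isGalois_fieldOfModuli_thetaClosure (hP : P ∈ UP) [hE : (thetaCurve P (thetaClosureField P)).IsElliptic] :
    IsGalois (fieldOfModuli (thetaCurve P (thetaClosureField P))) (thetaClosureField P) := by
  let φ : FMod P →+* fieldOfModuli (thetaCurve P (thetaClosureField P)) :=
    (algebraMap (FMod P) (thetaClosureField P)).codRestrict
      (fieldOfModuli (thetaCurve P (thetaClosureField P))).toSubring (algebraMap_fMod_mem_fieldOfModuli P hP.1)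
  letI : Algebra (FMod P) (fieldOfModuli (thetaCurve P (thetaClosureField P))) := φ.toAlgebra
  haveI : IsScalarTower (FMod P) (fieldOfModuli (thetaCurve P (thetaClosureField P))) (thetaClosureField P) :=
    IsScalarTower.of_algebraMap_eq fun _ => rfl
  haveI := isGalois_fMod_thetaClosureField P hP
  exact IsGalois.tower_top_of_isGalois (FMod P) (fieldOfModuli (thetaCurve P (thetaClosureField P)))
    (thetaClosureField P)

/-- **`[F‡ : ℚ(j(E_F))] ∣ [F‡ : F_mod]` is prime to every prime `l ≥ 7`** ([IUTchI] Def. 3.1 (b)).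
[claim: Mochizuki2012, status: disputed] -/
theorem finrank_fieldOfModuli_thetaClosure_coprime (hP : P ∈ UP)
    [hE : (thetaCurve P (thetaClosureField P)).IsElliptic] {l : ℕ} (hl : l.Prime) (h7 : 7 ≤ l) :
    (Module.finrank (fieldOfModuli (thetaCurve P (thetaClosureField P))) (thetaClosureField P)).Coprime l := by
  let φ : FMod P →+* fieldOfModuli (thetaCurve P (thetaClosureField P)) :=
    (algebraMap (FMod P) (thetaClosureField P)).codRestrict
      (fieldOfModuli (thetaCurve P (thetaClosureField P))).toSubring (algebraMap_fMod_mem_fieldOfModuli P hP.1)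
  letI : Algebra (FMod P) (fieldOfModuli (thetaCurve P (thetaClosureField P))) := φ.toAlgebra
  haveI : IsScalarTower (FMod P) (fieldOfModuli (thetaCurve P (thetaClosureField P))) (thetaClosureField P) :=
    IsScalarTower.of_algebraMap_eq fun _ => rfl
  haveI : Module.Free (FMod P) (fieldOfModuli (thetaCurve P (thetaClosureField P))) := Module.Free.of_divisionRing _ _
  haveI : Module.Free (fieldOfModuli (thetaCurve P (thetaClosureField P))) (thetaClosureField P) :=
    Module.Free.of_divisionRing _ _
  have hdvd : Module.finrank (fieldOfModuli (thetaCurve P (thetaClosureField P))) (thetaClosureField P) ∣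
      Module.finrank (FMod P) (thetaClosureField P) :=
    Dvd.intro_left _ (Module.finrank_mul_finrank (FMod P) (fieldOfModuli (thetaCurve P (thetaClosureField P)))
      (thetaClosureField P))
  exact Nat.Coprime.coprime_dvd_left hdvd (finrank_fMod_thetaClosureField_coprime P hP hl h7)

end Moduli

/-! ## The (P5) place, (P2) and (P6) over `F‡`; the initial Θ-data -/

section Data

variable [Fact P.InU]

omit [Fact P.InU] in
/-- A place of `F‡` over a place `v ∤ n` of `F_tpd` does not divide `n`. [cite: Mochizuki2012, IUTchIV Cor. 2.2 (ii) proof (P5) p. 46] -/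
theorem natCast_not_mem_of_liesOver {F : Type} [Field F] [NumberField F] [Algebra P.F F]
    (v : HeightOneSpectrum (𝓞 P.F)) (w : HeightOneSpectrum (𝓞 F)) [w.asIdeal.LiesOver v.asIdeal] {n : ℕ}
    (hv : ((n : ℕ) : 𝓞 P.F) ∉ v.asIdeal) : ((n : ℕ) : 𝓞 F) ∉ w.asIdeal := by
  intro hmem
  apply hv
  have h2 : (n : 𝓞 P.F) ∈ w.asIdeal.under (𝓞 P.F) := by
    rw [Ideal.mem_comap, map_natCast]; exact hmem
  rwa [← Ideal.LiesOver.over (P := w.asIdeal) (p := v.asIdeal)] at h2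

/-- **The `F‡`-level inputs of (P7)** from `P ∈ U_P`, a prime `l ≥ 7`, `AdmitsCore`, (P2), (P5), (P6): one (P5) place
of `F‡` (over the (P5) place of `F_tpd`: `ord_w j = e·ord_v j(λ) < 0`, semistable ⟹ multiplicative, `w ∤ 2l`), (P2) at
the (P5) places (`l ∤ e(w|v) ∣ [F‡ : F_tpd]`), (P6) over `F‡` (abc-iut-S5's transport UP the Galois extension `F‡/F_tpd`
of degree prime to `l` + abc-iut-L5-t12's bridge). [claim: Mochizuki2012, status: disputed] -/
theorem placeInput_thetaClosure (hP : P ∈ UP) [hE : (thetaCurve P (thetaClosureField P)).IsElliptic] {l : ℕ}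
    (hl : l.Prime) (h7 : 7 ≤ l) (hcore : AdmitsCore P) (hP2 : CondP2 P l) (hP5 : CondP5 P l) (h6 : CondP6 P l) :
    Nonempty (Semistable.PlaceInput (thetaCurve P (thetaClosureField P)) l) := by
  haveI : Fact l.Prime := ⟨hl⟩
  haveI : NeZero l := ⟨hl.ne_zero⟩
  have hU := hP.1
  have hss := isSemistable_thetaCurve_thetaClosureField P hU
  have hj : (thetaCurve P (thetaClosureField P)).j = algebraMap P.F (thetaClosureField P) (jInv P.x) := by
    have := thetaCurve_j (F := thetaClosureField P) hU
    convert this using 2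
  have hlF : ¬ l ∣ Module.finrank P.F (thetaClosureField P) :=
    (Nat.Prime.coprime_iff_not_dvd hl).1 (finrank_thetaClosureField_coprime P hU hl h7).symm
  -- (P2) at every multiplicative place of `F‡`
  have hP2' : ∀ w : HeightOneSpectrum (𝓞 (thetaClosureField P)),
      (thetaCurve P (thetaClosureField P)).HasMultiplicativeReductionAt w →
        ¬ ((l : ℤ) ∣ ord (thetaClosureField P) w (thetaCurve P (thetaClosureField P)).j) := by
    intro w hw
    have h := not_dvd_localHeight_of_condP2_of_not_dvd
      (EllPoint.mk (thetaClosureField P) (thetaCurve P (thetaClosureField P))) hj hl hlF hP2 w hw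
    rw [EllPoint.localHeight_eq_log] at h
    unfold ord
    rwa [dvd_neg]
  -- the (P5) place
  obtain ⟨v, hvj, hv2, hvl⟩ := hP5
  haveI : v.asIdeal.IsMaximal := v.isMaximal
  obtain ⟨⟨Pw, hPw⟩⟩ := (inferInstance : Nonempty (Ideal.primesOver v.asIdeal (𝓞 (thetaClosureField P))))
  haveI : Pw.IsPrime := hPw.1
  haveI : Pw.LiesOver v.asIdeal := hPw.2
  let w : HeightOneSpectrum (𝓞 (thetaClosureField P)) :=
    ⟨Pw, hPw.1, Ideal.ne_bot_of_liesOver_of_ne_bot v.ne_bot Pw⟩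
  haveI hwv : w.asIdeal.LiesOver v.asIdeal := hPw.2
  have he0 : v.asIdeal.ramificationIdx' w.asIdeal ≠ 0 :=
    Ideal.IsDedekindDomain.ramificationIdx'_ne_zero_of_liesOver w.asIdeal v.ne_bot
  have hord : ord (thetaClosureField P) w (thetaCurve P (thetaClosureField P)).j < 0 := by
    rw [hj, ord_algebraMap_of_liesOver (thetaClosureField P) v w]
    exact mul_neg_of_pos_of_neg (by exact_mod_cast Nat.pos_of_ne_zero he0) hvj
  have hmult := Literature.IUT.HodgeTheaters.hasMultiplicativeReductionAt_of_ord_j_neg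
    (thetaCurve P (thetaClosureField P)) hss hord
  have hw : w ∈ Semistable.badSet (thetaCurve P (thetaClosureField P)) l :=
    ⟨hmult, natCast_not_mem_of_liesOver P v w hv2, natCast_not_mem_of_liesOver P v w hvl⟩
  refine ⟨{ l_prime := hl
            seven_le_l := h7
            exists_bad := ⟨w, hw⟩
            not_dvd_ord := fun w' hw' => hP2' w' hw'.1
            imageContainsSL2 := ?_ }⟩
  exact imageContainsSL2_of_imageModLContainsSL2 (thetaCurve P (thetaClosureField P)) l
    (imageModLContainsSL2_of_condP6 hU hcore (by omega) h6 (thetaClosureField P) hlF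
      (thetaCurve P (thetaClosureField P)) hj)

/-- **[IUTchIV] Cor. 2.2 (ii) (P7) — EXISTENCE of initial Θ-data on `(F‡, E_λ ⊗ F‡, l)`**, for `P ∈ U_P`, a prime
`l ≥ 7`, `AdmitsCore`, (P2), (P5), (P6) — with `𝕍^bad_mod` the places of `F_mod` under the (P5) places AND the (P5)
choice (`ThetaData.IsP5Choice`) — GIVEN the `π₁`-geometric interface of [IUTchI] Def. 3.1 (d)(e)(f)
(`BadPlacePredicates`, `ThetaGeometry`: typed in the tree, constructed by campaign L, explicit binders).
[claim: Mochizuki2012, status: disputed] -/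
theorem exists_initialThetaData_thetaClosure (hP : P ∈ UP) [hE : (thetaCurve P (thetaClosureField P)).IsElliptic]
    {l : ℕ} [NeZero l] (hl : l.Prime) (h7 : 7 ≤ l) (hcore : AdmitsCore P) (hP2 : CondP2 P l) (hP5 : CondP5 P l)
    (h6 : CondP6 P l)
    (Pb : BadPlacePredicates (TorsionField (thetaCurve P (thetaClosureField P)) l))
    (geom : ThetaGeometry.{0}
      (AlgebraicClosure (thetaClosureField P) ≃ₐ[thetaClosureField P] AlgebraicClosure (thetaClosureField P))
      (galoisSubgroupOf (thetaClosureField P) (TorsionField (thetaCurve P (thetaClosureField P)) l)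
        (AlgebraicClosure (thetaClosureField P))) l)
    (hbad_type : ∀ w : Val (TorsionField (thetaCurve P (thetaClosureField P)) l),
      toVMod (thetaClosureField P) _ (thetaCurve P (thetaClosureField P)) w ∈
        Val.non '' Semistable.VbadModOf (thetaCurve P (thetaClosureField P)) l → Pb.IsTypeOneZModLPM w)
    (hbad_cusp : ∀ w : Val (TorsionField (thetaCurve P (thetaClosureField P)) l),
      toVMod (thetaClosureField P) _ (thetaCurve P (thetaClosureField P)) w ∈
        Val.non '' Semistable.VbadModOf (thetaCurve P (thetaClosureField P)) l → Pb.IsCanonicalGeneratorCusp w) :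
    ∃ D : InitialThetaData (thetaClosureField P) (TorsionField (thetaCurve P (thetaClosureField P)) l)
        (AlgebraicClosure (thetaClosureField P)) (thetaCurve P (thetaClosureField P)) l Pb,
      D.VbadMod = Semistable.VbadModOf (thetaCurve P (thetaClosureField P)) l ∧ ThetaData.IsP5Choice D := by
  obtain ⟨I⟩ := placeInput_thetaClosure P hP hl h7 hcore hP2 hP5 h6
  haveI := isGalois_fieldOfModuli_thetaClosure P hP
  exact Semistable.exists_initialThetaData_of_placeInput (thetaCurve P (thetaClosureField P))
    (exists_sq_eq_neg_one_thetaClosureField P) (torsion_thirty_rational_thetaClosure P hP.1)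
    (finrank_fieldOfModuli_thetaClosure_coprime P hP hl h7) I Pb geom hbad_type hbad_cusp

end Data

/-! ## `Cor22.ThetaDataExistsAt P l` from the binders of `stub_thetaData` and the interface -/

/-- **Child (i) «ThetaDataExists(P, l)» in the reading of record**: for `P ∈ U_P`, a prime `l` with `5 ≤ l`, `AdmitsCore`,
(P2), (P5), (P6) — the binders of `Cor22.Thm110Legendre` / `stub_thetaData` (they force `7 ≤ l`) — and the
`π₁`-geometric interface objects of [IUTchI] Def. 3.1 (d)(e)(f) over `(F‡, E_λ ⊗ F‡, l)`, the genuine Θ-volume datum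
type `Cor22.ThetaVolumeDatumAt P l` (v3) is INHABITED: `F := F‡(P)`, `E := E_λ ⊗ F‡`, `K := F‡(E[l])`,
`F̄ := F̄‡`, initial Θ-data by `exists_initialThetaData_thetaClosure`, ideles by `ThetaData.exists_isVolumeInputOf`.
[claim: Mochizuki2012, status: disputed] -/
theorem thetaDataExistsAt_of_condP6_thetaClosure [Fact P.InU] [(thetaCurve P (thetaClosureField P)).IsElliptic]
    (hP : P ∈ UP) {l : ℕ} [NeZero l] (hl : l.Prime) (h5 : 5 ≤ l)
    (hcore : AdmitsCore P) (hP2 : CondP2 P l) (hP5 : CondP5 P l) (h6 : CondP6 P l)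
    (Pb : BadPlacePredicates (TorsionField (thetaCurve P (thetaClosureField P)) l))
    (geom : ThetaGeometry.{0}
      (AlgebraicClosure (thetaClosureField P) ≃ₐ[thetaClosureField P] AlgebraicClosure (thetaClosureField P))
      (galoisSubgroupOf (thetaClosureField P) (TorsionField (thetaCurve P (thetaClosureField P)) l)
        (AlgebraicClosure (thetaClosureField P))) l)
    (hbad_type : ∀ w : Val (TorsionField (thetaCurve P (thetaClosureField P)) l),
      toVMod (thetaClosureField P) _ (thetaCurve P (thetaClosureField P)) w ∈
        Val.non '' Semistable.VbadModOf (thetaCurve P (thetaClosureField P)) l → Pb.IsTypeOneZModLPM w)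
    (hbad_cusp : ∀ w : Val (TorsionField (thetaCurve P (thetaClosureField P)) l),
      toVMod (thetaClosureField P) _ (thetaCurve P (thetaClosureField P)) w ∈
        Val.non '' Semistable.VbadModOf (thetaCurve P (thetaClosureField P)) l → Pb.IsCanonicalGeneratorCusp w) :
    ThetaDataExistsAt P l := by
  have h7 : 7 ≤ l := Literature.IUT.LogVolume.Cor22.seven_le_of_condP6 hP.1 hl h5 h6
  obtain ⟨D, hD, hP5c⟩ := exists_initialThetaData_thetaClosure P hP hl h7 hcore hP2 hP5 h6 Pb geom hbad_type hbad_cusp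
  obtain ⟨I, hI⟩ := ThetaData.exists_isVolumeInputOf D
  have hj : (thetaCurve P (thetaClosureField P)).j = algebraMap P.F (thetaClosureField P) (jInv P.x) := by
    have := thetaCurve_j (F := thetaClosureField P) hP.1
    convert this using 2
  exact ⟨{ F := thetaClosureField P
           K := TorsionField (thetaCurve P (thetaClosureField P)) l
           Fbar := AlgebraicClosure (thetaClosureField P)
           E := thetaCurve P (thetaClosureField P)
           j_eq := hj
           torsion_thirty_rational := torsion_thirty_rational_thetaClosure P hP.1
           isSubThetaField := isSubThetaField_thetaClosureField P hP.1
           Pb := Pb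
           D := D
           I := I
           isP5Choice := hP5c
           isVolumeInputOf := hI }⟩

end Cor22

end Literature.IUT.LogVolume

end
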